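import Summits.AtomisticToContinuum.Crystallization.Theorems.OverbindingBudgetEnergyAffineStraightening
import Summits.AtomisticToContinuum.Crystallization.Theorems.OverbindingBudgetEnergySiteDecomposition

/-!
# OverbindingBudget · decomp-a2c lens-4 g34 — part XXII-Q: layer profiles of a cube and the ABEL DRIFT bound (global half of STR-A, I)

Helper file under `--supports stmt-AtomisticToContinuum-31280` (RDEF = `Theses.OverbindingBudget.RobustDefectLimitWindows`); closes nothing.

The global half of STR-A `AffineStraightenedFloor` (part O) sums the site-level affine bound (part P) over the sites `F = Y ∩ cube` and must
compare, for each span length `k+1 ≤ s₀`, the `F`-sum of the span heights `Σ_{y∈F} H^±_k(y)` with `(k+1)·h̄·#F`, `h̄` the `F`-weighted mean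
ADJACENT gap height.  Writing `N_m = #(F ∩ layer m)` (the LAYER PROFILE of the cube) and `h_m = ⟪incr w m, n⟫`, Abel summation gives
`Σ_m N_m (h_{m+1+i} − h_{m+1}) = Σ_m (N_{m−1−i} − N_{m−1})(h_m − c)` for every constant `c`, whence the DRIFT BOUND
`|Σ_m N_m (h_{m+1+i} − h_{m+1})| ≤ ((η₂−η₁)/2)·i·TV`, `TV = Σ_m |N_{m+1} − N_m|` the total variation of the profile (§1, for any finitely supported
`N : ℤ → ℝ`).  §2 defines the layer index `layerOf` of a site, the profile `layerCount`, and regroups `F`-sums layer by layer; §3 states the one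
geometric input the global half then needs — `LayerProfileThin Λ₁`: `TV ≤ ε·#F` on large cubes (true: `TV ≤ #(Y ∩ ∂-shell of the cube) = O(ℓ²)`
by packing while `#F ≥ c ℓ³` by covering; [ANALYTIC·S], g35) — so that part R can prove `LayerProfileThin Λ₁ → AffineStraightenedFloor Λ₁`.
-/

noncomputable section

namespace Summit.AtomisticToContinuum.Crystallization.Theorems.OverbindingBudgetEnergyLayerProfile

open Real Finset
open scoped RealInnerProductSpace
open Summit.AtomisticToContinuum.Crystallization.Theorems.ChartedPlanarOrderChunkFloor (E3)
open Summit.AtomisticToContinuum.Crystallization.Theorems.ChartedPlanarOrderDensityDichotomy (IsSep)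
open Summit.AtomisticToContinuum.Crystallization.Theorems.ChartedPlanarOrderDoorLayered (Layered)
open Summit.AtomisticToContinuum.Crystallization.Theorems.ChartedPlanarOrderProfileSlavingLJ (incr)
open Summit.AtomisticToContinuum.Crystallization.Theorems.OverbindingBudgetRegistryCut (IsUnitNormal)
open Summit.AtomisticToContinuum.Crystallization.Theorems.OverbindingBudgetEnergySiteDecomposition (siteMap_injective)

/-! ## §1 Finitely supported profiles on `ℤ`: shifts, total variation, the Abel drift bound -/

section Abstract

variable {N h : ℤ → ℝ} {M : Finset ℤ}

/-- a profile vanishing off `M` vanishes at `m − j` unless `m ∈ M + j`. [this file] -/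
theorem vanish_sub (hN : ∀ m ∉ M, N m = 0) (j : ℤ) {m : ℤ} (hm : m ∉ M.image (· + j)) : N (m - j) = 0 := by
  apply hN
  intro h'
  exact hm (mem_image.2 ⟨m - j, h', by ring⟩)

/-- a finitely supported function's sum over any finset off which it vanishes is its `tsum`. [this file] -/
theorem sum_eq_tsum_of_vanish {f : ℤ → ℝ} {T : Finset ℤ} (hf : ∀ m ∉ T, f m = 0) : ∑ m ∈ T, f m = ∑' m, f m :=
  ((hasSum_sum_of_ne_finset_zero hf).tsum_eq).symm

/-- shift invariance of `tsum` over `ℤ`. [this file] -/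
theorem tsum_shift (f : ℤ → ℝ) (j : ℤ) : ∑' m, f (m + j) = ∑' m, f m :=
  (Equiv.addRight j).tsum_eq f

/-- the total variation of a profile. [this file] -/
def tv (N : ℤ → ℝ) : ℝ := ∑' m, |N (m + 1) - N m|

/-- the total variation is nonnegative. [this file] -/
theorem tv_nonneg (N : ℤ → ℝ) : 0 ≤ tv N := tsum_nonneg fun _ => abs_nonneg _

/-- shifted variation: `Σ_m |N(m − j − i) − N(m − j)| ≤ i·TV`. [this file] -/
theorem tsum_abs_shift_le (hN : ∀ m ∉ M, N m = 0) (j : ℤ) (i : ℕ) :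
    ∑' m, |N (m - j - i) - N (m - j)| ≤ i * tv N := by
  classical
  induction i with
  | zero => simp
  | succ i ih =>
    -- work on the finset `T` off which all three functions vanish
    set T : Finset ℤ := (M.image (· + (j + ((i : ℤ) + 1)))) ∪ (M.image (· + (j + (i : ℤ)))) ∪ (M.image (· + j)) with hT
    have v1 : ∀ m ∉ T, N (m - j - ((i : ℤ) + 1)) = 0 := fun m hm => by
      simp only [hT, mem_union, not_or] at hm
      have := vanish_sub hN (j + ((i : ℤ) + 1)) hm.1.1
      rwa [show m - (j + ((i : ℤ) + 1)) = m - j - ((i : ℤ) + 1) by ring] at this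
    have v2 : ∀ m ∉ T, N (m - j - (i : ℤ)) = 0 := fun m hm => by
      simp only [hT, mem_union, not_or] at hm
      have := vanish_sub hN (j + (i : ℤ)) hm.1.2
      rwa [show m - (j + (i : ℤ)) = m - j - (i : ℤ) by ring] at this
    have v3 : ∀ m ∉ T, N (m - j) = 0 := fun m hm => by
      simp only [hT, mem_union, not_or] at hm
      exact vanish_sub hN j hm.2
    have hA : ∀ m ∉ T, |N (m - j - ((i : ℤ) + 1)) - N (m - j)| = 0 := fun m hm => by rw [v1 m hm, v3 m hm]; simp
    have hB : ∀ m ∉ T, |N (m - j - ((i : ℤ) + 1)) - N (m - j - (i : ℤ))| = 0 := fun m hm => by rw [v1 m hm, v2 m hm]; simp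
    have hC : ∀ m ∉ T, |N (m - j - (i : ℤ)) - N (m - j)| = 0 := fun m hm => by rw [v2 m hm, v3 m hm]; simp
    push_cast
    rw [← sum_eq_tsum_of_vanish hA]
    have step : ∑ m ∈ T, |N (m - j - ((i : ℤ) + 1)) - N (m - j)| ≤
        ∑ m ∈ T, |N (m - j - ((i : ℤ) + 1)) - N (m - j - (i : ℤ))| + ∑ m ∈ T, |N (m - j - (i : ℤ)) - N (m - j)| := by
      rw [← sum_add_distrib]
      exact sum_le_sum fun m _ => abs_sub_le _ _ _
    have hshift : ∑ m ∈ T, |N (m - j - ((i : ℤ) + 1)) - N (m - j - (i : ℤ))| = tv N := by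
      rw [sum_eq_tsum_of_vanish hB, tv, ← tsum_shift (fun m => |N (m + 1) - N m|) (-(j + ((i : ℤ) + 1)))]
      refine tsum_congr fun m => ?_
      rw [show m + -(j + ((i : ℤ) + 1)) + 1 = m - j - (i : ℤ) by ring, show m + -(j + ((i : ℤ) + 1)) = m - j - ((i : ℤ) + 1) by ring,
        abs_sub_comm]
    rw [sum_eq_tsum_of_vanish hC] at step
    rw [hshift] at step
    linarith

/-- **ABEL DRIFT BOUND (upward spans).** For a profile `N` vanishing off `M` and gap heights `h` in `[η₁, η₂]`:
`|Σ_{m∈M} N_m (h_{m+1+i} − h_{m+1})| ≤ ((η₂−η₁)/2)·i·TV`. [this file] -/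
theorem drift_up_le {η₁ η₂ : ℝ} (hN : ∀ m ∉ M, N m = 0) (hh : ∀ m, η₁ ≤ h m ∧ h m ≤ η₂) (i : ℕ) :
    |∑ m ∈ M, N m * (h (m + 1 + i) - h (m + 1))| ≤ (η₂ - η₁) / 2 * i * tv N := by
  classical
  set c : ℝ := (η₁ + η₂) / 2 with hc
  have hhc : ∀ m, |h m - c| ≤ (η₂ - η₁) / 2 := fun m => by
    rw [abs_sub_le_iff]; constructor <;> linarith [(hh m).1, (hh m).2]
  -- Abel summation: move the shifts from `h` to `N`
  set T : Finset ℤ := (M.image (· + (1 + (i : ℤ)))) ∪ (M.image (· + (1 : ℤ))) with hT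
  have v1 : ∀ m ∉ T, N (m - 1 - (i : ℤ)) = 0 := fun m hm => by
    simp only [hT, mem_union, not_or] at hm
    have := vanish_sub hN (1 + (i : ℤ)) hm.1
    rwa [show m - (1 + (i : ℤ)) = m - 1 - (i : ℤ) by ring] at this
  have v2 : ∀ m ∉ T, N (m - 1) = 0 := fun m hm => by
    simp only [hT, mem_union, not_or] at hm
    exact vanish_sub hN 1 hm.2
  have e1 : ∑ m ∈ M, N m * (h (m + 1 + i) - c) = ∑ m ∈ T, N (m - 1 - (i : ℤ)) * (h m - c) := by
    rw [sum_eq_tsum_of_vanish (f := fun m => N m * (h (m + 1 + i) - c)) fun m hm => by rw [hN m hm, zero_mul],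
      sum_eq_tsum_of_vanish (f := fun m => N (m - 1 - (i : ℤ)) * (h m - c)) fun m hm => by rw [v1 m hm, zero_mul],
      ← tsum_shift (fun m => N (m - 1 - (i : ℤ)) * (h m - c)) (1 + (i : ℤ))]
    refine tsum_congr fun m => ?_
    rw [show m + (1 + (i : ℤ)) - 1 - (i : ℤ) = m by ring, show m + (1 + (i : ℤ)) = m + 1 + (i : ℤ) by ring]
  have e2 : ∑ m ∈ M, N m * (h (m + 1) - c) = ∑ m ∈ T, N (m - 1) * (h m - c) := by
    rw [sum_eq_tsum_of_vanish (f := fun m => N m * (h (m + 1) - c)) fun m hm => by rw [hN m hm, zero_mul],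
      sum_eq_tsum_of_vanish (f := fun m => N (m - 1) * (h m - c)) fun m hm => by rw [v2 m hm, zero_mul],
      ← tsum_shift (fun m => N (m - 1) * (h m - c)) 1]
    refine tsum_congr fun m => ?_
    rw [show m + 1 - 1 = m by ring]
  have e3 : ∑ m ∈ M, N m * (h (m + 1 + i) - h (m + 1)) = ∑ m ∈ T, (N (m - 1 - (i : ℤ)) - N (m - 1)) * (h m - c) := by
    have : ∀ m, N m * (h (m + 1 + i) - h (m + 1)) = N m * (h (m + 1 + i) - c) - N m * (h (m + 1) - c) := fun m => by ring
    simp_rw [this, sum_sub_distrib, e1, e2, ← sum_sub_distrib]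
    exact sum_congr rfl fun m _ => by ring
  rw [e3]
  calc |∑ m ∈ T, (N (m - 1 - (i : ℤ)) - N (m - 1)) * (h m - c)|
      ≤ ∑ m ∈ T, |(N (m - 1 - (i : ℤ)) - N (m - 1)) * (h m - c)| := abs_sum_le_sum_abs _ _
    _ ≤ ∑ m ∈ T, |N (m - 1 - (i : ℤ)) - N (m - 1)| * ((η₂ - η₁) / 2) :=
        sum_le_sum fun m _ => by rw [abs_mul]; exact mul_le_mul_of_nonneg_left (hhc m) (abs_nonneg _)
    _ = (η₂ - η₁) / 2 * ∑' m, |N (m - 1 - (i : ℤ)) - N (m - 1)| := by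
        rw [← sum_mul, mul_comm, sum_eq_tsum_of_vanish (f := fun m => |N (m - 1 - (i : ℤ)) - N (m - 1)|)]
        exact fun m hm => by rw [v1 m hm, v2 m hm]; simp
    _ ≤ (η₂ - η₁) / 2 * (i * tv N) := by
        have hω : 0 ≤ (η₂ - η₁) / 2 := by linarith [(hh 0).1, (hh 0).2]
        exact mul_le_mul_of_nonneg_left (tsum_abs_shift_le hN 1 i) hω
    _ = (η₂ - η₁) / 2 * i * tv N := by ring

/-- **ABEL DRIFT BOUND (downward spans).** `|Σ_{m∈M} N_m (h_{m−i} − h_m)| ≤ ((η₂−η₁)/2)·i·TV`. [this file] -/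
theorem drift_down_le {η₁ η₂ : ℝ} (hN : ∀ m ∉ M, N m = 0) (hh : ∀ m, η₁ ≤ h m ∧ h m ≤ η₂) (i : ℕ) :
    |∑ m ∈ M, N m * (h (m - i) - h m)| ≤ (η₂ - η₁) / 2 * i * tv N := by
  classical
  set c : ℝ := (η₁ + η₂) / 2 with hc
  have hhc : ∀ m, |h m - c| ≤ (η₂ - η₁) / 2 := fun m => by
    rw [abs_sub_le_iff]; constructor <;> linarith [(hh m).1, (hh m).2]
  set T : Finset ℤ := (M.image (· + (-(i : ℤ)))) ∪ M with hT
  have v1 : ∀ m ∉ T, N (m + (i : ℤ)) = 0 := fun m hm => by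
    simp only [hT, mem_union, not_or] at hm
    have := vanish_sub hN (-(i : ℤ)) hm.1
    rwa [show m - -(i : ℤ) = m + (i : ℤ) by ring] at this
  have v2 : ∀ m ∉ T, N m = 0 := fun m hm => by
    simp only [hT, mem_union, not_or] at hm
    exact hN m hm.2
  have e1 : ∑ m ∈ M, N m * (h (m - i) - c) = ∑ m ∈ T, N (m + (i : ℤ)) * (h m - c) := by
    rw [sum_eq_tsum_of_vanish (f := fun m => N m * (h (m - i) - c)) fun m hm => by rw [hN m hm, zero_mul],
      sum_eq_tsum_of_vanish (f := fun m => N (m + (i : ℤ)) * (h m - c)) fun m hm => by rw [v1 m hm, zero_mul],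
      ← tsum_shift (fun m => N (m + (i : ℤ)) * (h m - c)) (-(i : ℤ))]
    refine tsum_congr fun m => ?_
    rw [show m + -(i : ℤ) + (i : ℤ) = m by ring, show m + -(i : ℤ) = m - (i : ℤ) by ring]
  have e2 : ∑ m ∈ M, N m * (h m - c) = ∑ m ∈ T, N m * (h m - c) :=
    (sum_subset subset_union_right fun m _ hm => by rw [hN m hm, zero_mul])
  have e3 : ∑ m ∈ M, N m * (h (m - i) - h m) = ∑ m ∈ T, (N (m + (i : ℤ)) - N m) * (h m - c) := by
    have : ∀ m, N m * (h (m - i) - h m) = N m * (h (m - i) - c) - N m * (h m - c) := fun m => by ring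
    simp_rw [this, sum_sub_distrib, e1, e2, ← sum_sub_distrib]
    exact sum_congr rfl fun m _ => by ring
  rw [e3]
  have key : ∑' m, |N (m + (i : ℤ)) - N m| ≤ i * tv N := by
    have := tsum_abs_shift_le hN (-(i : ℤ)) i
    refine le_of_eq_of_le (tsum_congr fun m => ?_) this
    rw [abs_sub_comm, show m - -(i : ℤ) - (i : ℤ) = m by ring, show m - -(i : ℤ) = m + (i : ℤ) by ring]
  calc |∑ m ∈ T, (N (m + (i : ℤ)) - N m) * (h m - c)|
      ≤ ∑ m ∈ T, |(N (m + (i : ℤ)) - N m) * (h m - c)| := abs_sum_le_sum_abs _ _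
    _ ≤ ∑ m ∈ T, |N (m + (i : ℤ)) - N m| * ((η₂ - η₁) / 2) :=
        sum_le_sum fun m _ => by rw [abs_mul]; exact mul_le_mul_of_nonneg_left (hhc m) (abs_nonneg _)
    _ = (η₂ - η₁) / 2 * ∑' m, |N (m + (i : ℤ)) - N m| := by
        rw [← sum_mul, mul_comm, sum_eq_tsum_of_vanish (f := fun m => |N (m + (i : ℤ)) - N m|)]
        exact fun m hm => by rw [v1 m hm, v2 m hm]; simp
    _ ≤ (η₂ - η₁) / 2 * (i * tv N) := by
        have hω : 0 ≤ (η₂ - η₁) / 2 := by linarith [(hh 0).1, (hh 0).2]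
        exact mul_le_mul_of_nonneg_left key hω
    _ = (η₂ - η₁) / 2 * i * tv N := by ring

/-- the total variation is bounded by its finite partial sums' bound. [this file] -/
theorem tv_le_of_sum_le {C : ℝ} (h : ∀ T : Finset ℤ, ∑ m ∈ T, |N (m + 1) - N m| ≤ C) : tv N ≤ C :=
  Real.tsum_le_of_sum_le (fun _ => abs_nonneg _) h

end Abstract

/-! ## §2 The layer index of a site and the layer profile of a finite set of sites -/

open Classical in
/-- the layer index of a point of `Layered a b w` (junk `0` elsewhere). -/
def layerOf (a b : E3) (w : ℤ → E3) (y : E3) : ℤ :=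
  if hy : ∃ m : ℤ, ∃ i j : ℤ, y = ((i : ℝ) • a + (j : ℝ) • b) + w m then hy.choose else 0

/-- the layer profile of a finite set of sites: `N_m = #(F ∩ layer m)`. -/
def layerCount (a b : E3) (w : ℤ → E3) (F : Finset E3) (m : ℤ) : ℝ :=
  ((F.filter fun y => layerOf a b w y = m).card : ℝ)

/-- a point of `Layered a b w` lies in the layer of its layer index. [this file] -/
theorem layerOf_spec {a b : E3} {w : ℤ → E3} {y : E3} (hy : y ∈ Layered a b w) :
    ∃ i j : ℤ, y = ((i : ℝ) • a + (j : ℝ) • b) + w (layerOf a b w y) := by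
  have hy' : ∃ m : ℤ, ∃ i j : ℤ, y = ((i : ℝ) • a + (j : ℝ) • b) + w m := by
    obtain ⟨m, i, j, h⟩ := hy
    exact ⟨m, i, j, h⟩
  have h := hy'.choose_spec
  rw [layerOf, dif_pos hy']
  exact h

/-- with strictly increasing heights the layer index is determined by the site. [this file] -/
theorem layerOf_eq {a b n : E3} {w : ℤ → E3} (hab : LinearIndependent ℝ ![a, b]) (hn : IsUnitNormal a b n)
    (hmono : StrictMono fun m : ℤ => ⟪w m, n⟫) {m i j : ℤ} {y : E3} (hy : y = ((i : ℝ) • a + (j : ℝ) • b) + w m) :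
    layerOf a b w y = m := by
  have hyL : y ∈ Layered a b w := ⟨m, i, j, hy⟩
  obtain ⟨i', j', h'⟩ := layerOf_spec hyL
  have hinj := siteMap_injective hab hn hmono
  have := @hinj ⟨layerOf a b w y, (i', j')⟩ ⟨m, (i, j)⟩ (by simp only; rw [← h', ← hy])
  simpa using congrArg Prod.fst this

/-- the profile is nonnegative. [this file] -/
theorem layerCount_nonneg (a b : E3) (w : ℤ → E3) (F : Finset E3) (m : ℤ) : 0 ≤ layerCount a b w F m := Nat.cast_nonneg _

/-- the profile vanishes off the finset of layer indices met by `F`. [this file] -/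
theorem layerCount_vanish (a b : E3) (w : ℤ → E3) (F : Finset E3) :
    ∀ m ∉ F.image (layerOf a b w), layerCount a b w F m = 0 := by
  classical
  intro m hm
  simp only [layerCount, Nat.cast_eq_zero, card_eq_zero, filter_eq_empty_iff]
  intro y hy hym
  exact hm (mem_image.2 ⟨y, hy, hym⟩)

/-- **regrouping layer by layer**: `Σ_{y∈F} g(layer y) = Σ_m N_m·g m`. [this file] -/
theorem sum_eq_sum_layerCount (a b : E3) (w : ℤ → E3) (F : Finset E3) (g : ℤ → ℝ) :
    ∑ y ∈ F, g (layerOf a b w y) = ∑ m ∈ F.image (layerOf a b w), layerCount a b w F m * g m := by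
  classical
  rw [sum_comp]
  refine sum_congr rfl fun m _ => ?_
  rw [layerCount, nsmul_eq_mul]

/-- in particular `Σ_m N_m = #F`. [this file] -/
theorem sum_layerCount (a b : E3) (w : ℤ → E3) (F : Finset E3) :
    ∑ m ∈ F.image (layerOf a b w), layerCount a b w F m = F.card := by
  have h := sum_eq_sum_layerCount a b w F (fun _ => (1 : ℝ))
  simp only [mul_one, sum_const, nsmul_eq_mul] at h
  rw [← h]

/-! ## §3 The geometric input of the global half: thin layer profiles on large cubes -/

/-- **THIN `LayerProfileThin Λ₁`** — the ONE geometric input of the global half of STR-A.  For a `δ ≥ 9/10`-separated layered configuration over a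
cell `‖a‖, ‖b‖ ≤ Λ₁` (`a, b` independent) with unit normal `n` and all gap heights in `[3/8, 23/20]`, the layer profile `N_m = #(F ∩ layer m)` of the
sites `F = Y ∩ cube(c, ℓ)` has total variation `Σ_m |N_{m+1} − N_m| ≤ ε·#F` once `ℓ ≥ ℓ₁(ε)`.  Why true: consecutive layers are translates of one
another by a gap vector that may be taken of length `≤ 23/20 + 2Λ₁` (reduce its in-plane part modulo `ℤa + ℤb`), so `|N_{m+1} − N_m|` is at most the
number of sites of layers `m, m+1` within that distance of `∂cube`, and `Σ_m ≤ 2·#(Y ∩ shell) = O(ℓ²/δ³)` by packing, while `#F ≥ c·ℓ³` by covering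
(gaps `≤ 23/20`, cells `≤ Λ₁`).  Why it might fail: it does not. [ANALYTIC·S, TRUE] [piece] -/
def LayerProfileThin (Λ₁ : ℝ) : Prop :=
  ∀ δ : ℝ, 9 / 10 ≤ δ → ∀ (a b : E3) (w : ℤ → E3), LinearIndependent ℝ ![a, b] → ‖a‖ ≤ Λ₁ → ‖b‖ ≤ Λ₁ → IsSep δ (Layered a b w) →
    ∀ n : E3, IsUnitNormal a b n → (∀ m : ℤ, 3 / 8 ≤ ⟪incr w m, n⟫ ∧ ⟪incr w m, n⟫ ≤ 23 / 20) →
    ∀ ε : ℝ, 0 < ε → ∃ ℓ₁ : ℝ, ∀ ℓ : ℝ, ℓ₁ ≤ ℓ → ∀ (c : E3) (F : Finset E3),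
      (↑F : Set E3) = Layered a b w ∩ {z | ∀ i : Fin 3, c i ≤ z i ∧ z i < c i + ℓ} →
      ∀ T : Finset ℤ, ∑ m ∈ T, |layerCount a b w F (m + 1) - layerCount a b w F m| ≤ ε * F.card

end Summit.AtomisticToContinuum.Crystallization.Theorems.OverbindingBudgetEnergyLayerProfile

end
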